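import Summits.QuantumFields.BalabanUV.T4Continuum.Support.NE7MinimalOrbitUniqueGeneric
import Summits.QuantumFields.BalabanUV.T4Continuum.Support.NE7InteriorExistsGeneric
import Summits.QuantumFields.BalabanUV.T4Continuum.Support.NE7EtaRegularGaugeInvariance
import Summits.QuantumFields.BalabanUV.T4Continuum.Support.AveragingDeficitKDatum
import HarnessLib

/-!
# NE7AllMinimisersRegularGeneric — PORT MAP P3.4: (H∀)ᴱ FOR EVERY UNITARY GAUGE GROUP `U(n)` AND EVERY BLOCK SIZE `L ≥ 2`, `d = 4`, NO DISPLAYED HYPOTHESIS — `NE7AllMinimisersRegularSU2.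
# all_minimisers_regular_SU2` (gen 105, `card n = 2`, `L = 2`) RE-ISSUED GENERICALLY: over the small data, EVERY constrained minimiser of `sfClass 4 L N ε` at EVERY level is in the tree's
# energy class `Regular 4 L N ε g(ε, L, card n) k` ([Balaban1985Variational] Thm 1 (9) in the ENERGY form, every minimiser)

Cell `pub-balaban`, rung (B)+1 sub-cell t4, lineage `b2b-balaban-t4-ne7-p1`, generation 109 (CRUX PROVER NE7 #1 = OWNER of BINDER row NE7).  Memo
`t4/b2b-balaban-t4-ne7-p1-g109/ROAD-G109.md` §3 (PORT MAP item P3.4).  Argument = gen 105's: P3.2 (H∃)ᴱ gives a `Regular` minimiser `U₀`; P3.3 says every minimiser is a periodic unitary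
gauge copy of the orbit representative, as is `U₀`; `Regular` is gauge-invariant (`NE7EtaRegularGaugeInvariance.regular_gaugeAct`, any `L`).
WHAT ([folklore]; 0 def, 0 sorry).  **`all_minimisers_regular_generic`**.
HONEST FRAMING (page 1): composition of landed kernel theorems; nothing of Bałaban's asserted; constants existential; NOT NE7, NOT NE3; spine count unchanged; finite T⁴ rung (B)+1 — NOT infinite
volume, NOT mass gap, NOT BetaPertH, NOT Clay (continuum YM on T⁴ ⇐ BetaPertH ∧ nine spine estimates).
-/

set_option autoImplicit false

open scoped BigOperators Matrix Matrix.Norms.L2Operator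
open NormedSpace Finset Set

namespace Summit.QuantumFields.BalabanUV.T4Continuum.NE7AllMinimisersRegularGeneric

open Literature.MathematicalPhysics.QuantumFieldTheory.Balaban1983to89
open B7Prop1Explicit B7Prop2Explicit
open T4AveragingDeficitWall (IsUnitaryCfg SmallField)
open T4AveragingDeficitWallBoundary (IsPeriodicCfg)
open MinimalActionSandwich (IsMinimiser)
open MinimalActionRate (sfClass Regular)
open NE3EnergyShapes (IsUnitarySite IsPeriodicSite)
open NE7InteriorExistsGeneric (interior_exists_generic)
open NE7MinimalOrbitUniqueGeneric (minimal_orbit_unique_generic)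
open NE7EtaRegularGaugeInvariance (regular_gaugeAct)
open NE7EtaMinimiserGaugeCovariance (isUnitarySite_inv isPeriodicSite_inv)
open AveragingDeficitKDatum (gaugeAct_inv_gaugeAct)

noncomputable section

variable {n : Type} [Fintype n] [DecidableEq n]

/-- **(H∀)ᴱ FOR EVERY `U(n)` AND EVERY `L ≥ 2`, `d = 4`** (statement and argument in the file header). [folklore] -/
theorem all_minimisers_regular_generic [Nonempty n] {L : ℕ} (hL : 2 ≤ L) :
    ∃ ε₀ : ℝ, 0 < ε₀ ∧ ∀ ε : ℝ, 0 < ε → ε ≤ ε₀ → ∀ (N : ℕ) [NeZero N], 1 ≤ N →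
      ∃ δV : ℝ, 0 < δV ∧
        ∀ V ∈ {V : Site 4 → Fin 4 → (Matrix n n ℂ)ˣ | IsUnitaryCfg V ∧ IsPeriodicCfg V (N : ℤ) ∧ SmallField V δV},
        ∀ (k : ℕ) (U : Site 4 → Fin 4 → (Matrix n n ℂ)ˣ), IsMinimiser 4 (sfClass 4 L N ε) L N k V U →
          Regular 4 L N ε ((Fintype.card n : ℝ)
              * (624 * ((4 : ℕ) : ℝ) ^ 3 * ε ^ 2 * (1 + (((4 : ℕ) : ℝ) + 1) * ε) ^ 2
                  + 6768 * (Fintype.card (T4AveragingDeficitWall.Plane 4) : ℝ) ^ 2 * (4 : ℕ) * Fintype.card n * ε ^ 4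
                  + 16 * ((4 : ℕ) : ℝ) ^ 3 * ε ^ 2 * (L : ℝ) ^ 2)
            + 220 * (Fintype.card n : ℝ) * ((4 : ℕ) : ℝ) ^ 3 * ε ^ 3) k U := by
  have hL1 : 1 ≤ L := by omega
  obtain ⟨-, -, ε₁, hε₁, H1⟩ := interior_exists_generic (n := n) hL
  obtain ⟨ε₂, hε₂, H2⟩ := minimal_orbit_unique_generic (n := n) hL
  refine ⟨min ε₁ (min ε₂ (1 / 2)), lt_min hε₁ (lt_min hε₂ (by norm_num)), ?_⟩
  intro ε hε hεle N _ hN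
  have hεε₁ : ε ≤ ε₁ := hεle.trans (min_le_left _ _)
  have hεε₂ : ε ≤ ε₂ := hεle.trans ((min_le_right _ _).trans (min_le_left _ _))
  have hε1 : ε < 1 := by linarith [hεle.trans ((min_le_right _ _).trans (min_le_right _ _))]
  obtain ⟨β₀, hβ₀, H1'⟩ := H1 ε hε hεε₁
  obtain ⟨δ₁, hδ₁, hreg₁⟩ := H1' β₀ hβ₀ le_rfl N hN
  obtain ⟨δ₂, hδ₂, huniq⟩ := H2 ε hε hεε₂ N hN
  refine ⟨min δ₁ δ₂, lt_min hδ₁ hδ₂, ?_⟩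
  intro V hV k U hU
  obtain ⟨hVu, hVP, hVδ⟩ := hV
  have hV₁ : V ∈ {V : Site 4 → Fin 4 → (Matrix n n ℂ)ˣ | IsUnitaryCfg V ∧ IsPeriodicCfg V (N : ℤ) ∧ SmallField V δ₁} :=
    ⟨hVu, hVP, MinimalActionRate.SmallField.mono hVδ (min_le_left _ _)⟩
  have hV₂ : V ∈ {V : Site 4 → Fin 4 → (Matrix n n ℂ)ˣ | IsUnitaryCfg V ∧ IsPeriodicCfg V (N : ℤ) ∧ SmallField V δ₂} :=
    ⟨hVu, hVP, MinimalActionRate.SmallField.mono hVδ (min_le_right _ _)⟩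
  -- the regular minimiser of (H∃)ᴱ and the orbit representative
  obtain ⟨U₀, hU₀, hreg₀⟩ := hreg₁ V hV₁ k
  obtain ⟨Us, -, horbit⟩ := huniq V hV₂ k
  obtain ⟨u₀, hu₀, hu₀P, hg₀⟩ := horbit U₀ hU₀
  obtain ⟨u, hu, huP, hg⟩ := horbit U hU
  -- `U♯ = U₀^{u₀}` is regular, and `U = (U♯)^{u⁻¹}`
  have hregs := regular_gaugeAct hL1 hε1 hreg₀ hu₀ hu₀P
  rw [hg₀] at hregs
  have hU' : U = gaugeAct (fun z => (u z)⁻¹) Us := by rw [← hg, gaugeAct_inv_gaugeAct]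
  rw [hU']
  exact regular_gaugeAct hL1 hε1 hregs (isUnitarySite_inv hu) (isPeriodicSite_inv huP)

end

end Summit.QuantumFields.BalabanUV.T4Continuum.NE7AllMinimisersRegularGeneric
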